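import Summits.ValiantsHypothesis.ValiantsHypothesis.Theses.KPlusLogSqLaw
import Summits.ValiantsHypothesis.ValiantsHypothesis.Theorems.KPlusLogSqLawWeakLiftingBridge
import Summits.ValiantsHypothesis.ValiantsHypothesis.Theorems.LacunarySymmetroidMatrixDescartesCensusFrame
import Summits.ValiantsHypothesis.ValiantsHypothesis.Theorems.LacunarySymmetroidMatrixDescartesCensusExtremalVsCrux
import Summits.ValiantsHypothesis.ValiantsHypothesis.Theorems.KPlusLogSqLawTropicalBTwoRowSharp
import Summits.ValiantsHypothesis.ValiantsHypothesis.Theorems.KPlusLogSqLawSymmetricTwoKChain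

/-!
# Line `additive-lifting` («EXCESS») — crux `WeakLifting` (stmt-ValiantsHypothesis-19561, route KPlusLogSqLaw)

val-idea-1 (g2), tropical / Newton-polytope lens.  PUBLISHED, NOT REGISTERED (director-valiant KEY for
val-idea seats; R2266/R2348: ideators publish `Lines/…` and never run `skeleton check` on 19561/19771/18050).

HONEST FRAMING.  Every `def` below is a CANDIDATE LAW of the object-search cell's census game, none is
asserted; the only `sorry`s are the two law stubs.  What is PROVED here is bookkeeping between candidate
laws and the tree's census theorems: `AdditiveLifting → WeakLifting` (so the route's deciding theorem
`Theses.KPlusLogSqLaw.closes` runs on TB ∧ AdditiveLifting), the sandwich `B → AdditiveLifting`, hence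
`B ↔ TB ∧ AdditiveLifting` (with the tree's patchworking `tropKPlusLogSqLaw_of_kPlusLogSqLaw`), and the
located face `ExcessOne → RowTwoExcessOne → DoorA26`.  Nothing here bears on VP ≠ VNP: a law candidate
does not move Valiant's hypothesis (README §0 clause (c)).

THE LEVER (one object).  The EXCESS `ζ₊(m,K) − T(m,K)` of the symmetric real census over the tropical
census of the same format (T = `TropRootLawAt`, the sign-alternating dominant-chain capacity of
dominance designs; ζ₊ = `PosRootLawAt`).  Patchworking gives excess ≥ 0 format by format
(`le_card_posRoots_patch`, tree).  Every lifting statement in the tree and in the crux-idea cards budgets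
the real census MULTIPLICATIVELY in the tropical one — `Lifting` (× 2^{CK}), `WeakLifting`
(× 2^{C(K+log²m)}), `local-lifting` (× (μ+2)), `viro-ray-lifting` (folds PER tropical zero),
`octave-lifting` (scales × clusters).  The located census says the coupling is ADDITIVE with lifting
factor ONE:

  (m,K)      (2,3) (2,4) (2,5) (2,6)     (2,7)  (2,8)  (2,9)  (2,10) (3,3) (3,4)    (m,3), m ≤ 7
  T(m,K)       5     9    13    17        21    ≤ 25   ≤ 29   ≤ 33     9    19      ≥ C(m+2,2) − 2
  ζ₊_sym      5     9    14   18..19     ≥ 22   ≥ 25   ≥ 28   ≥ 30     9   18..19    C(m+2,2) − 1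
  excess       0     0     1    1..2      ≥ 1     ?      ?      ?       0    ≤ 0       ≤ 1

(kernel: `tropRootLawAt_two_sharp` T(2,K) ≤ 4K − 7, `bounds_2_5`, `k1_baseline`/`bounds_2_6'`,
`census_three_four_tight_bound'`; located: the cell's CENSUS.md Table S records and DATA-CUT-0823 l.556
(T(2,K) = 4K − 7 enumerated for K ≤ 7); paper: nothing.)  So the line files

* `AdditiveLifting` — ∃ C ∀ m K n, T(m,K) ≤ n → ζ₊(m,K) ≤ n + 2^{C(K+log²m)}: lifting factor 1, additive
  quasi-polynomial excess.  SANDWICHED: B → AdditiveLifting → WeakLifting (both proved below), and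
  B ↔ TB ∧ AdditiveLifting; so it is a legitimate C⁺ of the crux (same `closes`), strictly between B and
  WeakLifting, and NOT same-wall with WeakLifting (it forbids real/tropical ratios > 1 + o(1) in the window,
  which WeakLifting allows).
* `ExcessOne` — the sharp located form ∀ m K n, T(m,K) ≤ n → ζ₊(m,K) ≤ n + 1 («the symmetric real census
  exceeds the tropical census by at most one»).  Consistent with every decided cell above, SHARP at (2,5)
  and (2,7) (and at (2,6) iff ζ(2,6) = 18, the cell's 0.73-credence value), REFUTED FOR GENERAL
  (non-symmetric) pencils at (2,6) (CENSUS.md Table G: ζ_gen(2,6) = 20 = D against T(2,6) = 17) — so, exactly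
  as for the doors, SYMMETRY IS LOAD-BEARING and no mechanism for the symmetric cap is offered: it is filed
  as a KILLABLE conjecture with two-sided cheap tests (below), not as a belief.
* `RowTwoExcessOne` — its m = 2 face ζ₊(2,K) ≤ 4K − 6 (= T(2,K) + 1), whose first open instance is the K1
  door in the sharper form `PosRootLawAt 2 6 18` (`doorA26_of_rowTwoExcessOne`); Descartes for K ≤ 5
  (`rowTwoExcessOne_of_le_five`), within K − 2 of the kernel floor 3K − 4 (`SymTwoK.not_posRootLawAt_two`).

CHEAPEST FALSIFIERS (either side is informative).  REAL side: one symmetric pencil with ζ₊ ≥ T + 2 at a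
format with a kernel T-ceiling — (2,6) with 19 positive roots, (2,7) with 23, (2,8) with 27 — kills
`ExcessOne`/`RowTwoExcessOne` in the kernel (AdditiveLifting survives); a window family with
ζ₊ > T + 2^{C(K+log²m)} for every C kills `AdditiveLifting` (and then, given TB, B itself).  TROPICAL side
(finite searches the cell's tropical engines run in minutes): `ExcessOne` PREDICTS T(3,5) ≥ 26, T(4,4) ≥ 27,
T(5,4) ≥ 36, T(6,4) ≥ 44, T(4,5) ≥ 30, T(3,7) ≥ 34 from the symmetric floors 27, 28, 37, 45, 31, 35; any
kernel T-ceiling below one of these numbers kills it.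

[this cell; no citation exists for any `def` here.  Literature behind the lens: Viro patchworking /
Itenberg–Roy lower bounds (zbl:0870.14038), Hrubeš–Yehudayoff 2021 (doi:10.4230/LIPIcs.CCC.2021.9) for the
tropical side; Koiran–Portier–Tavenas (arXiv:1205.1015) for the real side.]
-/

set_option linter.dupNamespace false
set_option autoImplicit false

namespace Summit.ValiantsHypothesis.ValiantsHypothesis.Cruxes.WeakLifting.AdditiveLifting

open Summit.ValiantsHypothesis.ValiantsHypothesis.Theorems.LacunarySymmetroidMatrixDescartes
open Summit.ValiantsHypothesis.ValiantsHypothesis.Theorems.LacunarySymmetroidMatrixDescartes.TropicalCensus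
open Summit.ValiantsHypothesis.ValiantsHypothesis.Theorems.MatrixDescartes.Negative (PosRootLawAt)

/-! ## 1. The candidate laws (Props; never asserted) -/

/-- **excess row**: at format `(m, K)` the symmetric positive-root census exceeds the tropical census by at
most `E` — every tropical row bound `n` is a real row bound `n + E`. [candidate of this line] -/
def ExcessLawAt (m K E : ℕ) : Prop :=
  ∀ n : ℕ, TropRootLawAt m K n → PosRootLawAt m K (n + E)

/-- **ADDITIVE LIFTING** (the line's C⁺ of `WeakLifting`): lifting factor ONE plus an additive
quasi-polynomial excess `2^{C (K + ⌊log₂ m⌋²)}`.  `B → AdditiveLifting → WeakLifting`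
(`additiveLifting_of_kPlusLogSqLaw`, `weakLifting_of_additiveLifting`). [candidate of this line] -/
def AdditiveLifting : Prop :=
  ∃ C : ℕ, ∀ m K : ℕ, ExcessLawAt m K (2 ^ (C * (K + Nat.log 2 m ^ 2)))

/-- **EXCESS ONE** (sharp located form): the symmetric real census exceeds the tropical census by at most
one, at every format.  Consistent with all decided census cells; sharp at (2,5), (2,7); FALSE for general
(non-symmetric) pencils at (2,6) (Table G: 20 vs T = 17) — symmetry is load-bearing. [candidate of this line] -/
def ExcessOne : Prop :=
  ∀ m K : ℕ, ExcessLawAt m K 1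

/-- **two-row face of EXCESS ONE**: `ζ₊(2,K) ≤ 4K − 6 = T(2,K) + 1` for every `K ≥ 3`; first open
instance `K = 6` = the K1 door in the sharper form `PosRootLawAt 2 6 18`. [candidate of this line] -/
def RowTwoExcessOne : Prop :=
  ∀ K : ℕ, 3 ≤ K → PosRootLawAt 2 K (4 * K - 6)

/-! ## 2. The stubs (the ONLY sorries of the file) -/

/-- LAW STUB (safe form, sandwiched between B and WeakLifting). -/
theorem stub_additiveLifting : AdditiveLifting := by
  sorry

/-- LAW STUB (bold located form; implies the safe form with `C = 0`, `additiveLifting_of_excessOne`). -/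
theorem stub_excessOne : ExcessOne := by
  sorry

/-! ## 3. Composition — reaches `WeakLifting`, `KPlusLogSqLaw`, `ValiantsHypothesis` BY NAME (no sorry below) -/

theorem excessLawAt_mono {m K E E' : ℕ} (hEE' : E ≤ E') (h : ExcessLawAt m K E) : ExcessLawAt m K E' :=
  fun n hn => Census.posRootLawAt_mono (Nat.add_le_add_left hEE' n) (h n hn)

/-- `ExcessOne → AdditiveLifting` (take `C = 0`: `n + 1 = n + 2^0`). -/
theorem additiveLifting_of_excessOne (h : ExcessOne) : AdditiveLifting :=
  ⟨0, fun m K => by simpa using h m K⟩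

/-- arithmetic of the weak bridge: `2 (n + β) + 1 ≤ 2^{(C+2) s} (n + 1)` for `β = 2^{C s}`, `s ≥ 1`. -/
theorem two_mul_add_le (C s n : ℕ) (hs : 1 ≤ s) :
    2 * (n + 2 ^ (C * s)) + 1 ≤ 2 ^ ((C + 2) * s) * (n + 1) := by
  have hβ : 1 ≤ 2 ^ (C * s) := Nat.one_le_two_pow
  have h4 : 4 * 2 ^ (C * s) ≤ 2 ^ ((C + 2) * s) := by
    have h22 : 2 ^ 2 ≤ 2 ^ (2 * s) := Nat.pow_le_pow_right (by norm_num) (by omega)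
    calc 4 * 2 ^ (C * s) = 2 ^ 2 * 2 ^ (C * s) := by norm_num
      _ ≤ 2 ^ (2 * s) * 2 ^ (C * s) := Nat.mul_le_mul_right _ h22
      _ = 2 ^ ((C + 2) * s) := by rw [← pow_add]; ring_nf
  calc 2 * (n + 2 ^ (C * s)) + 1 ≤ 4 * 2 ^ (C * s) * (n + 1) := by nlinarith
    _ ≤ 2 ^ ((C + 2) * s) * (n + 1) := Nat.mul_le_mul_right _ h4

/-- **AdditiveLifting → WeakLifting** (the crux BY NAME): `ζ ≤ 2 ζ₊ + 1 ≤ 2 (n + β) + 1 ≤ 2^{(C+2)(K+L²)} (n+1)`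
(reflection transfer `Census.realRootLawAt_of_posRootLawAt`; the corner `K = 0` is `realRootLawAt_zero`). -/
theorem weakLifting_of_additiveLifting (h : AdditiveLifting) :
    Summit.ValiantsHypothesis.ValiantsHypothesis.Theses.KPlusLogSqLaw.WeakLifting := by
  obtain ⟨C, hC⟩ := h
  refine ⟨C + 2, fun m K n hT => ?_⟩
  rcases Nat.eq_zero_or_pos K with hK | hK
  · subst hK; exact realRootLawAt_zero m _
  · have h1 : PosRootLawAt m K (n + 2 ^ (C * (K + Nat.log 2 m ^ 2))) := hC m K n hT
    exact Census.realRootLawAt_mono (two_mul_add_le C _ n (by omega))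
      (Census.realRootLawAt_of_posRootLawAt h1)

/-- the crux, from the safe stub. -/
theorem WeakLifting_of : Summit.ValiantsHypothesis.ValiantsHypothesis.Theses.KPlusLogSqLaw.WeakLifting :=
  weakLifting_of_additiveLifting stub_additiveLifting

/-- **sandwich, upper side: B → AdditiveLifting** with no tropical input (B bounds the real row outright). -/
theorem additiveLifting_of_kPlusLogSqLaw (h : KPlusLogSqLaw) : AdditiveLifting := by
  obtain ⟨C, hC⟩ := h
  exact ⟨C, fun m K n _ =>
    Census.posRootLawAt_mono (Nat.le_add_left _ _) (Census.posRootLawAt_of_realRootLawAt (hC m K))⟩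

/-- **TB ∧ AdditiveLifting → B** (through the tree's weak bridge, p417903). -/
theorem kPlusLogSqLaw_of_trop_of_additiveLifting (hT : TropKPlusLogSqLaw) (hA : AdditiveLifting) :
    KPlusLogSqLaw :=
  kPlusLogSqLaw_of_weakLifting_of_tropKPlusLogSqLaw (weakLifting_of_additiveLifting hA) hT

/-- **B ↔ TB ∧ AdditiveLifting**: the additive split of Conjecture B is lossless (as the weak split is). -/
theorem kPlusLogSqLaw_iff_trop_and_additiveLifting :
    KPlusLogSqLaw ↔ (TropKPlusLogSqLaw ∧ AdditiveLifting) :=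
  ⟨fun h => ⟨tropKPlusLogSqLaw_of_kPlusLogSqLaw h, additiveLifting_of_kPlusLogSqLaw h⟩,
    fun h => kPlusLogSqLaw_of_trop_of_additiveLifting h.1 h.2⟩

/-- given TB, the three lifting statements B, AdditiveLifting, WeakLifting are equivalent. -/
theorem additiveLifting_iff_weakLifting_of_trop (hT : TropKPlusLogSqLaw) :
    AdditiveLifting ↔ Summit.ValiantsHypothesis.ValiantsHypothesis.Theses.KPlusLogSqLaw.WeakLifting :=
  ⟨weakLifting_of_additiveLifting,
    fun hW => additiveLifting_of_kPlusLogSqLaw (kPlusLogSqLaw_of_weakLifting_of_tropKPlusLogSqLaw hW hT)⟩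

/-- Conjecture B from the route's `TropicalB` and the safe stub (census currency). -/
theorem KPlusLogSqLaw_of (hT : Summit.ValiantsHypothesis.ValiantsHypothesis.Theses.KPlusLogSqLaw.TropicalB) :
    KPlusLogSqLaw :=
  kPlusLogSqLaw_of_trop_of_additiveLifting hT stub_additiveLifting

/-- the summit through the route's own deciding theorem `closes` (TB supplied, AdditiveLifting in place of
WeakLifting). -/
theorem valiant_of (hT : Summit.ValiantsHypothesis.ValiantsHypothesis.Theses.KPlusLogSqLaw.TropicalB) :
    _root_.ValiantsHypothesis :=
  Summit.ValiantsHypothesis.ValiantsHypothesis.Theses.KPlusLogSqLaw.closes hT WeakLifting_of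

/-! ## 4. The located face (records; no sorry) -/

/-- `ExcessOne` gives the two-row face through the kernel ceiling `T(2,K) ≤ 4K − 7`
(`KPlusLogSqLaw.tropRootLawAt_two_sharp`): `ζ₊(2,K) ≤ (4K − 7) + 1 = 4K − 6`. -/
theorem rowTwoExcessOne_of_excessOne (h : ExcessOne) : RowTwoExcessOne := fun K hK =>
  Census.posRootLawAt_mono (by omega) (h 2 K (4 * K - 7) (Summit.ValiantsHypothesis.ValiantsHypothesis.Theorems.KPlusLogSqLaw.tropRootLawAt_two_sharp K hK))

/-- the face holds for `K ≤ 5` by Descartes alone (`C(K+1,2) − 1 ≤ 4K − 6 ⟺ (K−2)(K−5) ≤ 0`):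
its content starts at `K = 6`. -/
theorem rowTwoExcessOne_of_le_five (K : ℕ) (h3 : 3 ≤ K) (h5 : K ≤ 5) : PosRootLawAt 2 K (4 * K - 6) := by
  have hD := Census.posRootLawAt_descartes 2 K (by omega)
  refine Census.posRootLawAt_mono ?_ hD
  interval_cases K <;> decide

/-- **first open instance = the K1 door, sharper**: `RowTwoExcessOne → DoorA26`
(`PosRootLawAt 2 6 18 → PosRootLawAt 2 6 19`). -/
theorem doorA26_of_rowTwoExcessOne (h : RowTwoExcessOne) : DoorA26 :=
  Census.posRootLawAt_mono (by norm_num) (h 6 (by norm_num))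

theorem doorA26_of_excessOne (h : ExcessOne) : DoorA26 :=
  doorA26_of_rowTwoExcessOne (rowTwoExcessOne_of_excessOne h)

/-- kernel sandwich of the face: `3K − 4 ≤ ζ₊(2,K)` (tree `SymTwoK.not_posRootLawAt_two`), so
`RowTwoExcessOne` is within `K − 2` of the kernel floor, and the tropical ceiling is `4K − 7`. -/
theorem rowTwo_floor_and_tropical_ceiling (K : ℕ) (hK : 3 ≤ K) :
    ¬ PosRootLawAt 2 K (3 * K - 5) ∧ TropRootLawAt 2 K (4 * K - 7) :=
  ⟨SymTwoK.not_posRootLawAt_two (K := K) hK, Summit.ValiantsHypothesis.ValiantsHypothesis.Theorems.KPlusLogSqLaw.tropRootLawAt_two_sharp K hK⟩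

end Summit.ValiantsHypothesis.ValiantsHypothesis.Cruxes.WeakLifting.AdditiveLifting
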